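import Mathlib

/-!
# Zhang (2022) §3, Lemmas 3.4–3.6 and the size of `Ψ₂`: the counting step

Trunk T-ANT (NumberTheory/LFunctions). Y. Zhang, *Discrete mean estimates and the Landau–Siegel
zero*, arXiv:2211.02515v1 (2022) [Zhang2022LandauSiegel], §3 [p. 7 of the source] and (2.10)
[p. 4]. Each of Lemmas 3.4, 3.5, 3.6 is concluded from a displayed SECOND-MOMENT bound over `Ψ`
by the words "Thus we conclude":

> `∑_{ψ∈Ψ} Y₄(ψ)² ≪ 𝔓𝓛¹⁶⁰²`, hence (3.4) `Y₄(ψ) < 𝓛¹¹⁷¹` for all but at most `O(𝔓𝓛⁻⁷⁴⁰)` ψ ∈ Ψ;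
> `∑_{ψ∈Ψ} Y₅(ψ)² ≪ P²𝓛⁻¹⁹⁹³ ≪ 𝔓𝓛⁻¹⁹⁰⁹`, hence (3.5) `Y₅(ψ) < 𝓛⁻⁵⁸⁵` for all but `O(𝔓𝓛⁻⁷³⁹)` ψ;
> `∑_{ψ∈Ψ} Y₆(ψ)² ≪ 𝔓𝓛⁻²⁰⁰⁵`, hence (3.6) `Y₆(ψ) < 𝓛⁻⁶³³` for all but `O(𝔓𝓛⁻⁷³⁹)` ψ;
> `Ψ₁ := {ψ ∈ Ψ : (3.4), (3.5), (3.6) hold}`, `Ψ₂ := Ψ ∖ Ψ₁`, and (2.10) `∑_{ψ∈Ψ₂} 1 ≪ 𝔓𝓛⁻⁷³⁹`.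

(`Y₄ = |X₁(D⁸⁰,ψ)| + |X₂(D⁸⁰,ψ)| + ∫₁^{D⁸⁰}(|X₁|+|X₂|)dx/x`, etc.; `𝔓 = ∑_{p∼P} p = (1+o(1))P²𝓛⁻⁷⁷`.)

**Status of the source: an unrefereed manuscript, a claimed result under adjudication.** This file
PROVES the elementary counting mechanism behind "Thus we conclude" and (2.10), in general form,
so that the implied constants are visible: the exceptional set of a second-moment bound `B` at
threshold `V` has at most `B/V²` elements (finite Chebyshev, `card_filter_mul_sq_le_sum_sq`,
`card_filter_le_div_sq`, and in the source's multiplicative shape `exceptional_card_le`: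
`∑ Y² ≤ C·𝔓·L^A ⇒ #{Y ≥ L^v} ≤ C·𝔓·L^{A−2v}` — the `O`-constant of the exception count IS the
`≪`-constant of the moment bound, nothing else enters), the complement of a triple conjunction is
bounded by the three exception counts (`card_filter_not_and₃_le`, this is (2.10) from Lemmas
3.4–3.6), and the four exponent identities `1602 − 2·1171 = −740`, `−1909 + 2·585 = −739`,
`−2005 + 2·633 = −739`, `−1993 + 77 ≤ −1909` (`lemma34_exponent` … `lemma35_moment_exponent`).
The second-moment bounds themselves (Lemmas 3.1–3.3, Cauchy) are NOT reproduced here (Lemma 3.3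
is: `Section3MeanValues.lean`). No statement about Theorems 1–2 of the source is made or implied.
-/

namespace Literature.NumberTheory.LFunctions.Zhang2022

open Finset

variable {ι : Type*}

/-! ### Finite Chebyshev -/

/-- Finite Chebyshev inequality: `#{i ∈ s : V ≤ f i} · V² ≤ ∑_{i ∈ s} (f i)²` for `0 ≤ V`.
[folklore] -/
theorem card_filter_mul_sq_le_sum_sq (s : Finset ι) (f : ι → ℝ) {V : ℝ} (hV : 0 ≤ V)
    [DecidablePred fun i => V ≤ f i] :
    ((s.filter fun i => V ≤ f i).card : ℝ) * V ^ 2 ≤ ∑ i ∈ s, f i ^ 2 := by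
  calc ((s.filter fun i => V ≤ f i).card : ℝ) * V ^ 2
      = ∑ i ∈ s.filter (fun i => V ≤ f i), V ^ 2 := by rw [sum_const, nsmul_eq_mul]
    _ ≤ ∑ i ∈ s.filter (fun i => V ≤ f i), f i ^ 2 :=
        sum_le_sum fun i hi => pow_le_pow_left₀ hV (mem_filter.1 hi).2 2
    _ ≤ ∑ i ∈ s, f i ^ 2 :=
        sum_le_sum_of_subset_of_nonneg (filter_subset _ _) fun i _ _ => sq_nonneg _

/-- The exceptional set of a second-moment bound: if `∑_{i∈s} (f i)² ≤ B` and `V > 0` then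
`#{i ∈ s : V ≤ f i} ≤ B / V²`. [folklore] -/
theorem card_filter_le_div_sq (s : Finset ι) (f : ι → ℝ) {V B : ℝ} (hV : 0 < V)
    (hB : ∑ i ∈ s, f i ^ 2 ≤ B) [DecidablePred fun i => V ≤ f i] :
    ((s.filter fun i => V ≤ f i).card : ℝ) ≤ B / V ^ 2 := by
  rw [le_div_iff₀ (by positivity)]
  exact (card_filter_mul_sq_le_sum_sq s f hV.le).trans hB

/-- The source's shape of the counting step ("Thus we conclude", Lemmas 3.4–3.6): a second-moment
bound `∑_{ψ∈Ψ} Y(ψ)² ≤ C·𝔓·L^A` with `L > 0` gives `#{ψ ∈ Ψ : Y(ψ) ≥ L^v} ≤ C·𝔓·L^{A − 2v}`;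
the implied constant of the exception count is the implied constant `C` of the moment bound.
[cite: Zhang2022LandauSiegel, Lemmas 3.4–3.6] -/
theorem exceptional_card_le (s : Finset ι) (Y : ι → ℝ) {C P L A v : ℝ} (hL : 0 < L)
    (h : ∑ i ∈ s, Y i ^ 2 ≤ C * P * L ^ A) [DecidablePred fun i => L ^ v ≤ Y i] :
    ((s.filter fun i => L ^ v ≤ Y i).card : ℝ) ≤ C * P * L ^ (A - 2 * v) := by
  have hV : 0 < L ^ v := Real.rpow_pos_of_pos hL v
  refine (card_filter_le_div_sq s Y hV h).trans_eq ?_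
  rw [Real.rpow_sub hL, mul_comm (2 : ℝ) v, Real.rpow_mul hL.le, Real.rpow_two, mul_div_assoc]

/-! ### (2.10): `#Ψ₂` from the three exception counts -/

/-- `Ψ₂ = Ψ ∖ Ψ₁` with `Ψ₁ = {ψ : (3.4) ∧ (3.5) ∧ (3.6)}`: the number of `ψ ∈ Ψ` failing at least
one of three conditions is at most the sum of the three exception counts — with Lemmas 3.4–3.6
this is (2.10), `#Ψ₂ ≤ O(𝔓𝓛⁻⁷⁴⁰) + O(𝔓𝓛⁻⁷³⁹) + O(𝔓𝓛⁻⁷³⁹) ≪ 𝔓𝓛⁻⁷³⁹`.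
[cite: Zhang2022LandauSiegel, (2.10)] -/
theorem card_filter_not_and₃_le (s : Finset ι) (p q r : ι → Prop) [DecidablePred p]
    [DecidablePred q] [DecidablePred r] :
    (s.filter fun i => ¬(p i ∧ q i ∧ r i)).card ≤
      (s.filter fun i => ¬p i).card + (s.filter fun i => ¬q i).card +
        (s.filter fun i => ¬r i).card := by
  classical
  calc (s.filter fun i => ¬(p i ∧ q i ∧ r i)).card
      ≤ ((s.filter fun i => ¬p i) ∪ (s.filter fun i => ¬q i) ∪ (s.filter fun i => ¬r i)).card := by
        refine card_le_card fun i hi => ?_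
        simp only [mem_union, mem_filter] at hi ⊢
        tauto
    _ ≤ ((s.filter fun i => ¬p i) ∪ (s.filter fun i => ¬q i)).card +
          (s.filter fun i => ¬r i).card := card_union_le _ _
    _ ≤ _ := Nat.add_le_add_right (card_union_le _ _) _

/-- Real form of (2.10): three exception counts `≤ C₄·𝔓·L⁻⁷⁴⁰, C₅·𝔓·L⁻⁷³⁹, C₆·𝔓·L⁻⁷³⁹` with
`L ≥ 1` add up to `≤ (C₄ + C₅ + C₆)·𝔓·L⁻⁷³⁹`. [cite: Zhang2022LandauSiegel, (2.10)] -/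
theorem card_Psi₂_le {n₄ n₅ n₆ : ℕ} {C₄ C₅ C₆ P L : ℝ} (hL : 1 ≤ L) (hC₄ : 0 ≤ C₄) (hP : 0 ≤ P)
    (h₄ : (n₄ : ℝ) ≤ C₄ * P * L ^ (-740 : ℝ)) (h₅ : (n₅ : ℝ) ≤ C₅ * P * L ^ (-739 : ℝ))
    (h₆ : (n₆ : ℝ) ≤ C₆ * P * L ^ (-739 : ℝ)) :
    ((n₄ + n₅ + n₆ : ℕ) : ℝ) ≤ (C₄ + C₅ + C₆) * P * L ^ (-739 : ℝ) := by
  have hL0 : 0 < L := one_pos.trans_le hL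
  have hmono : L ^ (-740 : ℝ) ≤ L ^ (-739 : ℝ) :=
    Real.rpow_le_rpow_of_exponent_le hL (by norm_num)
  have h₄' : (n₄ : ℝ) ≤ C₄ * P * L ^ (-739 : ℝ) :=
    h₄.trans (mul_le_mul_of_nonneg_left hmono (mul_nonneg hC₄ hP))
  push_cast
  nlinarith [h₄', h₅, h₆]

/-! ### The exponent identities of Lemmas 3.4–3.6 -/

/-- Lemma 3.4: moment `𝔓𝓛¹⁶⁰²`, threshold `𝓛¹¹⁷¹`, exceptions `𝔓𝓛^{1602−2·1171} = 𝔓𝓛⁻⁷⁴⁰`.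
[cite: Zhang2022LandauSiegel, Lemma 3.4] -/
theorem lemma34_exponent : (1602 : ℤ) - 2 * 1171 = -740 := by norm_num

/-- Lemma 3.5: moment `𝔓𝓛⁻¹⁹⁰⁹`, threshold `𝓛⁻⁵⁸⁵`, exceptions `𝔓𝓛^{−1909+2·585} = 𝔓𝓛⁻⁷³⁹`.
[cite: Zhang2022LandauSiegel, Lemma 3.5] -/
theorem lemma35_exponent : (-1909 : ℤ) + 2 * 585 = -739 := by norm_num

/-- Lemma 3.5, the moment bound's first step `P²𝓛⁻¹⁹⁹³ ≪ 𝔓𝓛⁻¹⁹⁰⁹`: with `P² = (1+o(1))𝔓𝓛⁷⁷`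
((2.9)) the left side is `𝔓𝓛^{−1993+77} = 𝔓𝓛⁻¹⁹¹⁶`, and `−1916 ≤ −1909` (slack `𝓛⁷`).
[cite: Zhang2022LandauSiegel, Lemma 3.5] -/
theorem lemma35_moment_exponent : (-1993 : ℤ) + 77 = -1916 ∧ (-1916 : ℤ) ≤ -1909 := by norm_num

/-- Lemma 3.6: moment `𝔓𝓛⁻²⁰⁰⁵`, threshold `𝓛⁻⁶³³`, exceptions `𝔓𝓛^{−2005+2·633} = 𝔓𝓛⁻⁷³⁹`.
[cite: Zhang2022LandauSiegel, Lemma 3.6] -/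
theorem lemma36_exponent : (-2005 : ℤ) + 2 * 633 = -739 := by norm_num

end Literature.NumberTheory.LFunctions.Zhang2022
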